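import Summits.QuantumAdvantage.AdviceFreeQNC0.AdviceFreeQNC0
import Summits.QuantumAdvantage.AdviceFreeQNC0.WalkTube
import HarnessLib

/-!
# Cell qa-qnc0 (rungs F-Q1-exp / F-Q1⁺): the `√n`-degree ladder above F-Q1 — STATEMENTS

Planner qa-qnc0-p2 g12, ROUND-12 §A / `Sketch12b.lean` §2, §4, §6, typed VERBATIM (statements only; shared by
the proof files `SqrtDegreeHardness.lean` — P1/P2 proved, `WalkHardLinSqrt` and `RingHardLinSqrt 2` unconditional —
and `ExpBridge.lean` — the exponential bridge E4):

* §2  **E1 `WalkHardLinSqrt`**, **E2 `RingHardLinSqrt p`** — the u-walk game / the ring relation are hard for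
  `𝔽₂`-degree `K·⌊√n⌋` (what α's tube bound really gives: `tubePlan` uses the degree only through `D ≤ ⌊√n⌋`).
* §4  **F-Q1-exp `HLFNotFAC0ModExp p`** — 2D HLF versus EXPONENTIAL-size `AC⁰[p]/rpoly` (size `≤ 2^M` whenever
  `c_d·(M + log₂ N)^{d+1} ≤ N`), one gap for all depths, uniform random bits, no advice on either side.
* §6  the plan implications **P1 `WalkHardLinSqrtPlan`**, **P2 `RingHardLinSqrtPlan`** (P3 `ExpBridgePlan` mentions
  `LongGridCycle` and is typed in `ExpBridge.lean`).

WHAT THIS IS NOT: statements only — nothing is proved in this file; nothing on `GC⁰(k)[p]` (Sketch12b §5, whose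
basis `ballGates`/`gcBasis` is `Literature/Computability/Complexity/BallGates.lean`); separation NOT moved.
-/

namespace Summit.QuantumAdvantage.AdviceFreeQNC0

open Finset
open Literature.Computability.Cryptography Literature.Computability.Complexity
open Literature.Computability.QuantumComplexity Literature.Computability.MetaComplexity

/-! ### §2 The `√n`-degree inputs (p = 2; re-runs of landed proofs) -/

/-- **E1 `WalkHardLinSqrt`** (Sketch12b §2, verbatim) — walk hardness at every charge for strategies of
`𝔽₂`-degree `≤ K·⌊√n⌋`, one threshold `θ_K < 1` per slope `K`.  PLAN: verbatim re-run of `WalkTubeRank.tubePlan`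
with `(Nat.log 2 n)^C` replaced by `K * Nat.sqrt n` (`BinomTailLower (C₁ + K)` instead of `(C₁ + 1)`, threshold
`n ≥ 4 (C₁ + K)²`; the tube bound `TubeBound` is degree-generic).  Size S. -/
def WalkHardLinSqrt : Prop :=
  ∀ K : ℕ, ∃ θ : ℝ, θ < 1 ∧ ∃ n₀ : ℕ, ∀ n ≥ n₀, ∀ c : ℕ,
    ∀ y : Fin (n + 1) → (Fin n → Bool) → Bool, (∀ g, HasDeg (y g) (K * Nat.sqrt n)) →
      ((univ.filter fun u : Fin n → Bool => ringWinU c y u = true).card : ℝ) ≤ θ * (2 : ℝ) ^ n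

/-- **E2 `RingHardLinSqrt p`** (Sketch12b §2, verbatim) — the ring crux at degree `K·⌊√n⌋`, ALL lengths
`n ≥ n₀(K)`, one threshold per `K`.  PLAN (p = 2): verbatim re-run of `WalkTransport.ringHard_two_of_walkHard`
from `WalkHardLinSqrt` (the chart `xOfU` is `𝔽₂`-affine, `hasDeg_transport` keeps the degree; bookkeeping
`K·⌊√(n+1)⌋ ≤ (K+1)·⌊√n⌋`).  Size S.  (`RingHard p` is the family `(log₂ n)^c`, which `RingHardLinSqrt p`
implies via `WalkTubeRank.logPow_le_natSqrt`.) -/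
def RingHardLinSqrt (p : ℕ) [Fact p.Prime] : Prop :=
  ∀ K : ℕ, ∃ θ : ℝ, θ < 1 ∧ ∃ n₀ : ℕ, ∀ n ≥ n₀,
    ∀ P : Fin n → Smolensky.CubeFn (ZMod p) n,
      (∀ i, P i ∈ Smolensky.lowDeg (ZMod p) n (K * Nat.sqrt n)) →
      ((univ.filter fun x : Fin n → Bool =>
          RingHLF.Rel x (fun i => decide (P i x = 1))).card : ℝ) ≤ θ * (2 : ℝ) ^ n

/-! ### §4 The exponential target -/

/-- **F-Q1-exp(p) `HLFNotFAC0ModExp p`** (Sketch12b §4, verbatim): 2D HLF is hard for EXPONENTIAL-size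
`AC⁰[p]/rpoly`.  `HLFNotFAC0Mod p` with the polynomial size bound replaced by `size ≤ 2^M` for every `M` with
`c_d·(M + log₂ N)^{d+1} ≤ N` (so size `2^{Ω(N^{1/(d+1)})} = 2^{Ω(n_in^{1/(2d+2)})}`), ONE gap `θ < 1` for all
depths, uniform shared random bits, no advice.  Implies `HLFNotFAC0Mod p` (`ExpBridge.lean`,
`hlfNotFAC0Mod_of_exp`).  PLAN: `RingFrameBridge.hlfNotFAC0Mod_of_ringHard8` re-run on a long cycle
(`LongGridCycle.lean`) with `ℓ = M + 2 log₂ N + O_δ(1)` and the degree budget `((p-1)ℓ)^{d+1} ≤ ⌊√n⌋` from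
`RingHardLinSqrt p` at `K = 1`.  Size M. -/
def HLFNotFAC0ModExp (p : ℕ) : Prop :=
  ∃ θ : ℝ, θ < 1 ∧ ∀ d : ℕ, ∃ c N₀ : ℕ, ∀ N ≥ N₀, ∀ M : ℕ, c * (M + Nat.log 2 N) ^ (d + 1) ≤ N →
    ∀ (r : ℕ) (Cs : Fin N × Fin N → Circuit (Fin (inLen N + r))),
      (∀ v, (Cs v).IsOver (accBasis p)) → (∀ v, (Cs v).acDepth ≤ d) →
      (∀ v, (Cs v).size ≤ 2 ^ M) →
      ∃ I : HLFInstance N, I.IsValid ∧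
        uniformProb r
          {ρ | (fun v => (Cs v).eval (Fin.append (encodeHLF I) fun i => ρ.getD i false)) ∈
            hlfSolutions I} ≤ θ

/-! ### §6 The plan implications (each one prover task) -/

/-- **P1 `WalkHardLinSqrtPlan`** (Sketch12b §6, verbatim; S): the tube bound at slope-`K` square-root degree. -/
def WalkHardLinSqrtPlan : Prop := TubeMass → BinomTailLower → WalkHardLinSqrt

/-- **P2 `RingHardLinSqrtPlan`** (Sketch12b §6, verbatim; S): ring ← walk transport at square-root degree
(p = 2). -/
def RingHardLinSqrtPlan : Prop := WalkHardLinSqrt → RingHardLinSqrt 2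

end Summit.QuantumAdvantage.AdviceFreeQNC0
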